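import Mathlib
import Summits.ResolutionOfSingularities.ResolutionOfSingularities.Theorems.RadicialJungCleanModelsLens5TFrameLayer2
import HarnessLib

/-!
# Route `RadicialJung`, crux `CleanModels` (stmt-15917): T⁗ port part 8/13 — §G⁗.C PORT 4⁗ PROVED: `frameChartPort` (source :2208–2468)

PORT (line lead `res-B-lead-1` g8, for Sketch rev 32) of res-B-lens-5's crux workfiles `Cruxes/DescentPerfectToAll/Lens5_TFrame.lean` rev 4
(crux ae884a356928; author res-B-lens-5 g15; `lean check` rc 0 · 0 sorries · 0 warnings; crit-1 TRIAGE-146/150 PASS) and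
`Cruxes/DescentPerfectToAll/Lens5_PDegreeCount.lean` rev 3 (crux 100289d6413b; TRIAGE-151 PASS): THEOREMS T⁗ / T⁗′ / T⁗″ / T⁗‴ — the slice
{`[Γ:pΓ] = p²`, `k` of FINITE `p`-rank `r`, `[κ_v : κ_v^p] = p^r`} of the research stub `stub_cleanLU3DefectNonDiscrete` (valuations of MINIMAL
Frobenius defect `d(K|K^p, v) = p`, ANY such ground field: no perfectness, no separability of `K/k` or `κ_v/k`), modulo F-02 `CossartPiltant2019` and
F-32 (`hEmb`) only.  The port is split into def-free modules `…Lens5TFrame{RG,IR,Graded,Port2,Port4Core,Layer,Layer2,Port4,Composition,PMon,PDegreeA,PDegreeB,PDegreeC}`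
over ONE currency module `…Lens5TFrameCurrency` (the authors' `def`s, verbatim); declarations VERBATIM, namespace
`Summit.ResolutionOfSingularities.ResolutionOfSingularities.Theorems.RadicialJungCleanModels.Lens5TFrame` (the authors' §A copy of
`Lens5_PDegreeSep` and the constant-frame corollaries `cleanLU3DefectPRankTwoSepFin_of_frame` / `…SepFin_of_cossartPiltant2019'` are not ported).
OURS · counted 0 · nothing here proves resolution in characteristic `p`.


-/

set_option linter.dupNamespace false -- mandated namespace of this single-conjunct summit

section

open IsLocalRing
open Literature.AlgebraicGeometry.Resolution
open Summit.ResolutionOfSingularities.ResolutionOfSingularities.Theorems.RadicialJung.CleanModels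
open Summit.ResolutionOfSingularities.ResolutionOfSingularities.Theorems.RadicialJung.CleanModels.Lens5
open Summit.ResolutionOfSingularities.ResolutionOfSingularities.Theorems.RadicialJung.CleanModels.Lens5.PRankTwoCurrency
open Summit.ResolutionOfSingularities.ResolutionOfSingularities.Theorems.RadicialJung.CleanModels.Lens5.PRankTwoAssembly
open Summit.ResolutionOfSingularities.ResolutionOfSingularities.Theorems.RadicialJungCleanModels.Lens5RegularityCriterion
open Summit.ResolutionOfSingularities.ResolutionOfSingularities.Theorems.RadicialJungCleanModels.Lens5ChartSurjection

namespace Summit.ResolutionOfSingularities.ResolutionOfSingularities.Theorems.RadicialJungCleanModels.Lens5TFrame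

/-! ## §G⁗.C — PORT 4⁗ PROVED: `theorem frameChartPort : FrameChartPort p` (memo §23.4 (F0)–(F5)) -/

set_option maxHeartbeats 1600000 in
/-- **PORT 4⁗ PROVED** (memo §23.4 (F0)–(F5), kernel-checked, sorry-free).  `A'' := k[gens A₂, u, u_{≥ρ}⁻¹, t]`; the frame-free chart ring
`S₀ := locAtCentre k[gens A₂, u, u_{≥ρ}⁻¹] O` is regular with a parameter `ψ ∈ M` by Port 4b's argument (Part A, its dimension `3` coming from
`S := locAtCentre A'' O` by integrality), `S = ⊕_s W_s S₀` is free over `S₀` with `𝔪_S = 𝔪_{S₀} S` by RG/DG (Part B), hence regular of the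
same dimension, and `ψ` stays a regular parameter. [folklore] -/
theorem frameChartPort (p : ℕ) [Fact p.Prime] : FrameChartPort p := by
  intro k _ K _ _ O A hAO hAfg hFrac hdimA hdim3 hzd M A₂ hA₂O hA₂fg hAp hA₂M hreg₂ hdimT z hzT hz0 hzv hzspan
    S _ W hWO hWv hRG x y hx hy hxp hyp hvx hvy hLI hV hP hDG t htO hAt h1t hWt hWWt ρ hρ u hu0 hupos huzero huM hupres hzu L _ σ htu
  classical
  haveI := hFrac
  haveI := hreg₂
  have hp : p.Prime := Fact.out
  haveI : NeZero p := ⟨hp.ne_zero⟩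
  have hk : ∀ c : k, algebraMap k K c ∈ A₂ := fun c => A₂.algebraMap_mem c
  have huO : ∀ j, u j ∈ O := fun j => (O.valuation_le_one_iff _).mp (by
    by_cases hj : (j : ℕ) < ρ
    · exact (hupos j hj).le
    · exact (huzero j (not_lt.mp hj)).le)
  have huinvO : ∀ j : Fin 3, ρ ≤ (j : ℕ) → (u j)⁻¹ ∈ O := fun j hj =>
    (O.valuation_le_one_iff _).mp (by rw [map_inv₀, huzero j hj, inv_one])
  obtain ⟨gens₂, hgens₂⟩ := hA₂fg
  have hgensA₂ : ∀ x ∈ gens₂, x ∈ A₂ := fun x hx => by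
    rw [← hgens₂]; exact Algebra.subset_adjoin (Finset.mem_coe.mpr hx)
  have hTM : ∀ r ∈ locAtCentre A₂.toSubring O, r ∈ M := hA₂M
  -- the parameters as elements of `T` and `𝔪_T = (z)`
  set zT : Fin 3 → locAtCentre A₂.toSubring O := fun i => ⟨z i, hzT i⟩ with hzTdef
  have hzspanT : Ideal.span (Set.range zT) = IsLocalRing.maximalIdeal (locAtCentre A₂.toSubring O) := by
    apply le_antisymm
    · rw [Ideal.span_le]
      rintro _ ⟨i, rfl⟩
      exact (mem_maximalIdeal_locAtCentre_iff hA₂O _).mpr (hzv i)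
    · intro r hr
      obtain ⟨b, hbT, hrb⟩ := hzspan r r.2 ((mem_maximalIdeal_locAtCentre_iff hA₂O r).mp hr)
      have hr' : r = ∑ i, (⟨b i, hbT i⟩ : locAtCentre A₂.toSubring O) * zT i := by
        apply Subtype.ext
        rw [hrb]
        change _ = (locAtCentre A₂.toSubring O).subtype
          (∑ i : Fin 3, (⟨b i, hbT i⟩ : locAtCentre A₂.toSubring O) * zT i)
        rw [map_sum]
        exact Finset.sum_congr rfl fun i _ => rfl
      rw [hr']
      exact Ideal.sum_mem _ fun i _ => Ideal.mul_mem_left _ _ (Ideal.subset_span ⟨i, rfl⟩)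
  have hzuT : ∀ i : Fin 3, ∃ (ε : K) (d : Fin 3 → ℤ), ε ∈ locAtCentre A₂.toSubring O ∧ O.valuation ε = 1 ∧
      (∀ j : Fin 3, (j : ℕ) < ρ → 0 ≤ d j) ∧ (∃ j : Fin 3, (j : ℕ) < ρ ∧ 0 < d j) ∧ ((zT i : K)) = ε * ∏ j, u j ^ d j := hzu
  -- (F0) the frame-free chart generators `G₀ = gens A₂ ∪ u ∪ u_{≥ρ}⁻¹` and `A₀'' := k[G₀]`
  set Z : Finset (Fin 3) := Finset.univ.filter (fun j => ρ ≤ (j : ℕ)) with hZdef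
  have hZ : ∀ j : Fin 3, j ∈ Z ↔ ρ ≤ (j : ℕ) := fun j => by simp [hZdef]
  set G₀ : Finset K := gens₂ ∪ Finset.univ.image u ∪ Z.image (fun j => (u j)⁻¹) with hG₀def
  have hG₀gens : ∀ g ∈ gens₂, g ∈ G₀ := fun g hg => by
    rw [hG₀def]; exact Finset.mem_union_left _ (Finset.mem_union_left _ hg)
  have hG₀u : ∀ j, u j ∈ G₀ := fun j => by
    rw [hG₀def]
    exact Finset.mem_union_left _ (Finset.mem_union_right _ (Finset.mem_image.mpr ⟨j, Finset.mem_univ _, rfl⟩))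
  have hG₀uinv : ∀ j : Fin 3, ρ ≤ (j : ℕ) → (u j)⁻¹ ∈ G₀ := fun j hj => by
    rw [hG₀def]
    exact Finset.mem_union_right _ (Finset.mem_image.mpr ⟨j, (hZ j).mpr hj, rfl⟩)
  have hG₀cases : ∀ x ∈ G₀, x ∈ gens₂ ∨ (∃ j, x = u j) ∨ (∃ j : Fin 3, ρ ≤ (j : ℕ) ∧ x = (u j)⁻¹) := by
    intro x hx
    rw [hG₀def] at hx
    rcases Finset.mem_union.mp hx with hx | hx
    · rcases Finset.mem_union.mp hx with hx | hx
      · exact Or.inl hx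
      · obtain ⟨j, -, rfl⟩ := Finset.mem_image.mp hx
        exact Or.inr (Or.inl ⟨j, rfl⟩)
    · obtain ⟨j, hj, rfl⟩ := Finset.mem_image.mp hx
      exact Or.inr (Or.inr ⟨j, (hZ j).mp hj, rfl⟩)
  have hG₀O : ∀ x ∈ G₀, x ∈ O := by
    intro x hx
    rcases hG₀cases x hx with hx | ⟨j, rfl⟩ | ⟨j, hj, rfl⟩
    · exact hA₂O (hgensA₂ x hx)
    · exact huO j
    · exact huinvO j hj
  set A₀'' : Subalgebra k K := Algebra.adjoin k (G₀ : Set K) with hA₀''def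
  have hG₀A₀'' : ∀ x ∈ G₀, x ∈ A₀'' := fun x hx => Algebra.subset_adjoin (Finset.mem_coe.mpr hx)
  let Oₖ : Subalgebra k K :=
    { O.toSubring with algebraMap_mem' := fun c => hA₂O (A₂.algebraMap_mem c) }
  have hG₀O' : (G₀ : Set K) ⊆ (Oₖ : Set K) := fun x hx => by
    change x ∈ O; exact hG₀O x (Finset.mem_coe.mp hx)
  have hA₀''O : A₀''.toSubring ≤ O.toSubring := fun x hx => (Algebra.adjoin_le hG₀O' : A₀'' ≤ Oₖ) hx
  have hA₂A₀'' : A₂ ≤ A₀'' := by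
    rw [← hgens₂]; exact Algebra.adjoin_le fun x hx => hG₀A₀'' x (hG₀gens x (Finset.mem_coe.mp hx))
  have hTS₀ : locAtCentre A₂.toSubring O ≤ locAtCentre A₀''.toSubring O :=
    locAtCentre_mono O (fun x hx => hA₂A₀'' hx)
  have hA₀''S₀ : ∀ x ∈ A₀'', x ∈ locAtCentre A₀''.toSubring O := fun x hx => le_locAtCentre _ O hx
  -- the frame chart `A'' := k[G₀ ∪ t]`
  set G : Finset K := G₀ ∪ t with hGdef
  set A'' : Subalgebra k K := Algebra.adjoin k (G : Set K) with hA''def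
  have hGA'' : ∀ x ∈ G, x ∈ A'' := fun x hx => Algebra.subset_adjoin (Finset.mem_coe.mpr hx)
  have hGO : ∀ x ∈ G, x ∈ O := by
    intro x hx
    rw [hGdef] at hx
    rcases Finset.mem_union.mp hx with hx | hx
    · exact hG₀O x hx
    · exact htO x hx
  have hGO' : (G : Set K) ⊆ (Oₖ : Set K) := fun x hx => by
    change x ∈ O; exact hGO x (Finset.mem_coe.mp hx)
  have hA''O : A''.toSubring ≤ O.toSubring := fun x hx => (Algebra.adjoin_le hGO' : A'' ≤ Oₖ) hx
  have hG₀G : ∀ x ∈ G₀, x ∈ G := fun x hx => by rw [hGdef]; exact Finset.mem_union_left _ hx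
  have htG : ∀ a ∈ t, a ∈ G := fun a ha => by rw [hGdef]; exact Finset.mem_union_right _ ha
  have h0le : A₀'' ≤ A'' := Algebra.adjoin_le fun x hx => hGA'' x (hG₀G x (Finset.mem_coe.mp hx))
  have htA'' : ∀ a ∈ t, a ∈ A'' := fun a ha => hGA'' a (htG a ha)
  have hAA'' : A ≤ A'' := hAt.trans (Algebra.adjoin_le fun x hx => htA'' x (Finset.mem_coe.mp hx))
  have hA''fg : A''.FG := ⟨G, hA''def.symm⟩
  have hWA'' : ∀ s, W s ∈ A'' := fun s => htA'' _ (hWt s)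
  -- (F2 input) the `M`-monomial layer: every element of `A₀''` is `Σ_{a,b<p} m_{ab} x^a y^b` with `m_{ab} ∈ M`
  set mono : Fin p × Fin p → K := fun ab => x ^ (ab.1 : ℕ) * y ^ (ab.2 : ℕ) with hmonodef
  have hmonoRed : ∀ (m : K), m ∈ M → ∀ a b : ℕ, HasExp M.toSubring mono (m * (x ^ a * y ^ b)) := by
    intro m hm a b
    have hx' : x ^ a = (x ^ p) ^ (a / p) * x ^ (a % p) := by rw [← pow_mul, ← pow_add, Nat.div_add_mod]
    have hy' : y ^ b = (y ^ p) ^ (b / p) * y ^ (b % p) := by rw [← pow_mul, ← pow_add, Nat.div_add_mod]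
    have key : HasExp M.toSubring mono ((m * ((x ^ p) ^ (a / p) * (y ^ p) ^ (b / p))) *
        mono (⟨a % p, Nat.mod_lt _ hp.pos⟩, ⟨b % p, Nat.mod_lt _ hp.pos⟩)) :=
      hasExp_single (S₀ := M.toSubring) (M.mul_mem hm (M.mul_mem (pow_mem hxp _) (pow_mem hyp _))) _
    have heq : m * (x ^ a * y ^ b) = (m * ((x ^ p) ^ (a / p) * (y ^ p) ^ (b / p))) *
        mono (⟨a % p, Nat.mod_lt _ hp.pos⟩, ⟨b % p, Nat.mod_lt _ hp.pos⟩) := by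
      simp only [hmonodef]
      rw [hx', hy']; ring
    rw [heq]; exact key
  have hmonoWW : ∀ s t, HasExp M.toSubring mono (mono s * mono t) := by
    intro s t
    have : mono s * mono t = 1 * (x ^ ((s.1 : ℕ) + t.1) * y ^ ((s.2 : ℕ) + t.2)) := by
      simp only [hmonodef]; ring
    rw [this]; exact hmonoRed 1 M.one_mem _ _
  have hN₁A₀'' : ∀ a ∈ A₀'', HasExp M.toSubring mono a := by
    intro a ha
    rw [hA₀''def] at ha
    induction ha using Algebra.adjoin_induction with
    | mem g hg =>
      rcases hG₀cases g (Finset.mem_coe.mp hg) with hg | ⟨j, rfl⟩ | ⟨j, hj, rfl⟩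
      · have := hmonoRed g (hTM _ (le_locAtCentre _ O (hgensA₂ g hg))) 0 0
        simpa using this
      · obtain ⟨e, a, b, hj⟩ := hupres j
        have hzM : (∏ i, z i ^ e i) ∈ M := prod_mem fun i _ => zpow_mem (hTM _ (hzT i)) _
        rw [hj]; exact hmonoRed _ hzM a b
      · have := hmonoRed (u j)⁻¹ (M.inv_mem (huM j hj)) 0 0
        simpa using this
    | algebraMap c =>
      have := hmonoRed _ (hTM _ (le_locAtCentre _ O (hk c))) 0 0
      simpa using this
    | add _ _ _ _ ih₁ ih₂ => exact hasExp_add ih₁ ih₂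
    | mul _ _ _ _ ih₁ ih₂ => exact hasExp_mul hmonoWW ih₁ ih₂
  -- (F2) RG over the `M`-monomial layer, from DG and the ultrametric inequality
  have hRG₁ : ∀ e : S → K, (∀ s, HasExp M.toSubring mono (e s)) →
      ∀ s₀, O.valuation (e s₀ * W s₀) ≤ O.valuation (∑ s, e s * W s) := by
    intro e he s₀
    choose m hmM hme using he
    have htot : ∑ s, e s * W s =
        ∑ l : S × (Fin p × Fin p), m l.1 l.2 * (W l.1 * (x ^ (l.2.1 : ℕ) * y ^ (l.2.2 : ℕ))) := by
      rw [Fintype.sum_prod_type]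
      refine Finset.sum_congr rfl fun s _ => ?_
      rw [hme s, Finset.sum_mul]
      refine Finset.sum_congr rfl fun ab _ => ?_
      simp only [hmonodef]; ring
    rw [htot, hme s₀, Finset.sum_mul]
    refine Valuation.map_sum_le _ fun ab _ => ?_
    have h := hDG (fun l => m l.1 l.2) (fun l => hmM l.1 l.2) (s₀, ab)
    have heq : m s₀ ab * mono ab * W s₀ = m s₀ ab * (W s₀ * (x ^ (ab.1 : ℕ) * y ^ (ab.2 : ℕ))) := by
      simp only [hmonodef]; ring
    rw [heq]; exact h
  -- (F2) RG over `S₀ := locAtCentre A₀'' O` (common denominator of value `1`)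
  have RG₀ : ∀ e : S → K, (∀ s, e s ∈ locAtCentre A₀''.toSubring O) →
      ∀ s₀, O.valuation (e s₀ * W s₀) ≤ O.valuation (∑ s, e s * W s) := by
    intro e he s₀
    have hfr : ∀ s, ∃ a c : K, a ∈ A₀'' ∧ c ∈ A₀'' ∧ O.valuation c = 1 ∧ e s = a / c := fun s => by
      obtain ⟨a, ha, c, hc, hvc, h⟩ := mem_locAtCentre_iff.mp (he s)
      exact ⟨a, c, ha, hc, hvc, h⟩
    choose a c haA hcA hvc hec using hfr
    have hc0 : ∀ s, c s ≠ 0 := fun s => ne_zero_of_valuation_eq_one (hvc s)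
    set C : K := ∏ s, c s with hCdef
    have hvC : O.valuation C = 1 := by
      rw [hCdef, map_prod]; exact Finset.prod_eq_one fun s _ => hvc s
    have hCe : ∀ s, HasExp M.toSubring mono (C * e s) := by
      intro s
      have heq : C * e s = (∏ s' ∈ Finset.univ.erase s, c s') * a s := by
        rw [hCdef, ← Finset.prod_erase_mul _ _ (Finset.mem_univ s), hec s]
        have := hc0 s
        field_simp
      rw [heq]
      exact hN₁A₀'' _ (A₀''.mul_mem (prod_mem fun s' _ => hcA s') (haA s))
    have h := hRG₁ (fun s => C * e s) hCe s₀
    have heq : ∑ s, C * e s * W s = C * ∑ s, e s * W s := by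
      rw [Finset.mul_sum]; exact Finset.sum_congr rfl fun s _ => by ring
    have hL : O.valuation (C * e s₀ * W s₀) = O.valuation (e s₀ * W s₀) := by
      rw [mul_assoc, map_mul, hvC, one_mul]
    have hR : O.valuation (∑ s, C * e s * W s) = O.valuation (∑ s, e s * W s) := by
      rw [heq, map_mul, hvC, one_mul]
    rw [hL, hR] at h
    exact h
  -- (F1 input) the normal forms: `t ⊆ N := Σ_s W_s S₀`, hence `A'' ⊆ N`
  have hcoefNF : ∀ (ν : K) (d : Fin 3 → ℤ), (ν = 0 ∨ (ν ∈ locAtCentre A₂.toSubring O ∧ O.valuation ν = 1)) →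
      (∀ j : Fin 3, (j : ℕ) < ρ → 0 ≤ d j) → ν * ∏ j, u j ^ d j ∈ locAtCentre A₀''.toSubring O := by
    intro ν d hν hd
    have hν' : ν ∈ locAtCentre A₀''.toSubring O := by
      rcases hν with rfl | ⟨h, -⟩
      · exact Subring.zero_mem _
      · exact hTS₀ h
    refine Subring.mul_mem _ hν' (prod_mem fun j _ => ?_)
    by_cases hj : (j : ℕ) < ρ
    · exact zpow_mem_of_nonneg (hA₀''S₀ _ (hG₀A₀'' _ (hG₀u j))) (hd j hj)
    · exact zpow_mem_of_inv_mem (hA₀''S₀ _ (hG₀A₀'' _ (hG₀u j)))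
        (hA₀''S₀ _ (hG₀A₀'' _ (hG₀uinv j (not_lt.mp hj)))) (d j)
  have htExp : ∀ a ∈ t, HasExp (locAtCentre A₀''.toSubring O) W a := by
    intro a ha
    obtain ⟨ν, d, hν, hd, rfl⟩ := htu a ha
    refine hasExp_sum _ _ fun l _ => ?_
    have heq : ν l * W (σ l) * ∏ j, u j ^ d l j = (ν l * ∏ j, u j ^ d l j) * W (σ l) := by ring
    rw [heq]
    exact hasExp_single (hcoefNF (ν l) (d l) (hν l) (hd l)) (σ l)
  have h1 : HasExp (locAtCentre A₀''.toSubring O) W 1 := htExp 1 h1t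
  have hWW : ∀ s s', HasExp (locAtCentre A₀''.toSubring O) W (W s * W s') := fun s s' => htExp _ (hWWt s s')
  have hgenN : ∀ a ∈ A'', HasExp (locAtCentre A₀''.toSubring O) W a := by
    intro a ha
    rw [hA''def] at ha
    induction ha using Algebra.adjoin_induction with
    | mem g hg =>
      have hg' : g ∈ G := Finset.mem_coe.mp hg
      rw [hGdef] at hg'
      rcases Finset.mem_union.mp hg' with hg' | hg'
      · have := hasExp_mul_left (hA₀''S₀ _ (hG₀A₀'' g hg')) h1
        rwa [mul_one] at this
      · exact htExp g hg'
    | algebraMap c =>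
      have := hasExp_mul_left (hA₀''S₀ _ (hA₂A₀'' (hk c))) h1
      rwa [mul_one] at this
    | add _ _ _ _ ih₁ ih₂ => exact hasExp_add ih₁ ih₂
    | mul _ _ _ _ ih₁ ih₂ => exact hasExp_mul hWW ih₁ ih₂
  -- dimensions: `dim S = 3` (the centre is closed, `dim A'' = dim A = 3`), `dim S₀ = dim S` (integrality)
  have hdimAeq : ringKrullDim A = 3 := ringKrullDim_eq_three_of_locAtCentre O A hAO hdimA hdim3
  have hdimA'' : ringKrullDim A'' = 3 := by
    rw [Summit.ResolutionOfSingularities.ResolutionOfSingularities.Theorems.RadicialJung.CleanModels.ringKrullDim_eq_of_fg_of_le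
      hAfg hA''fg hAA'', hdimAeq]
  have hmaxS : (subringCentre A''.toSubring O hA''O).IsMaximal := hzd A''.toSubring hA''O (fun x hx => hAA'' hx)
  have hdimS : ringKrullDim (locAtCentre A''.toSubring O) = 3 := by
    rw [Summit.ResolutionOfSingularities.ResolutionOfSingularities.Theorems.RadicialJung.CleanModels.ringKrullDim_locAtCentre_eq_of_isMaximal
      A'' hA''fg O hA''O hmaxS, hdimA'']
  have hdimS₀ : ringKrullDim (locAtCentre A₀''.toSubring O) = 3 := by
    rw [ringKrullDim_eq_of_frame O hA''O h0le hWA'' hWv RG₀ hgenN]; exact hdimS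
  -- Part A on the frame-free chart: `S₀` is regular with a parameter `ψ₀ ∈ M`
  have hG₀cases' : ∀ x ∈ G₀, x ∈ A₂ ∨ (∃ j, x = u j) ∨ (∃ j : Fin 3, ρ ≤ (j : ℕ) ∧ x = (u j)⁻¹) ∨
      (∃ (L : Type) (_ : Fintype L) (ν : L → K) (d : L → Fin 3 → ℤ),
        (∀ l, ν l = 0 ∨ (ν l ∈ locAtCentre A₂.toSubring O ∧ O.valuation (ν l) = 1)) ∧
        (∀ l, ∀ j : Fin 3, (j : ℕ) < ρ → 0 ≤ d l j) ∧ x = ∑ l, ν l * ∏ j, u j ^ d l j) := by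
    intro x hx
    rcases hG₀cases x hx with hx | h | h
    · exact Or.inl (hgensA₂ x hx)
    · exact Or.inr (Or.inl h)
    · exact Or.inr (Or.inr (Or.inl h))
  obtain ⟨hreg₀, ψ₀, hψ₀1, hψ₀2, hψ₀M⟩ := port_regularParameter_core O M A₂ hA₂O hA₂M hreg₂ zT hzspanT ρ hρ u hu0 hupos
    huzero huM hzuT G₀ hG₀O hG₀u hG₀uinv hA₂A₀'' hG₀cases' hdimS₀
  -- Part B: `S` is regular and `ψ₀` stays a regular parameter
  haveI : IsRegularLocalRing (locAtCentre A₀''.toSubring O) := hreg₀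
  have hregS : IsRegularLocalRing (locAtCentre A''.toSubring O) :=
    isRegularLocalRing_of_frame O hA''O h0le hA''fg hWA'' hWv RG₀ hgenN
  haveI := hregS
  have hle : locAtCentre A₀''.toSubring O ≤ locAtCentre A''.toSubring O := locAtCentre_mono O (fun x hx => h0le hx)
  refine ⟨A'', hA''O, hAA'', hA''fg, hregS, ⟨(ψ₀ : K), hle ψ₀.2⟩, ?_⟩
  obtain ⟨hψ1, hψ2⟩ := regularParameter_of_frame O hA''O h0le hWA'' hWv RG₀ hgenN ψ₀ hψ₀1 hψ₀2 ⟨(ψ₀ : K), hle ψ₀.2⟩ rfl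
  exact ⟨hψ1, hψ2, hψ₀M⟩

end Summit.ResolutionOfSingularities.ResolutionOfSingularities.Theorems.RadicialJungCleanModels.Lens5TFrame

end
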